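import Summits.Ventures.Crystal3D.Theorems.StickyWulffConstantTextureLiminfTexShadowTerraceCensusDefs
import HarnessLib

/-!
# The census of every twin word of length ≥ 3 is at least `4√2/9 > 13/25`: the B-table of mechanism (β) is needed for Σ9 words only
# (lane T, crux `TextureLiminfV5`, stmt-Ventures-23912, EDGE-ON residual F_A; cf-p1 RULING (ccxxv)(3); 19480-p1 g17 memo LAMELLA-CENSUS-g17 §3(iv))

HONEST FRAMING. Venture `Summits/Ventures/Crystal3D` (cell `crystal3d-full`), route `route-Ventures-StickyWulffConstant`, helper `--supports` the law-v5
crux `TextureLiminfV5` (stmt-Ventures-23912), lane T.  An ELEMENTARY inequality about the census weight `censusSum` (…TerraceCensusDefs, p726089); nothing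
about any wall, configuration or certificate; the census theorem `TerraceCensusAt` itself is NOT touched; F-C1 not moved.

THE POINT.  The census bound of (β) is `½ Σ_k sin θ_k`, `θ_k` the inclination to the wall normal `e₃` of the `k`-th spatial twin-plane normal `v_k` of the word.
Consecutive normals of a reduced admissible word meet at `|cos| = 1/3`, and the first and third at `|cos| ≤ 7/9` (`= 7/9` exactly for the `x·y·x` words);
with the **sine triangle inequality** `√(1 − ⟪u,e⟫²) + √(1 − ⟪v,e⟫²) ≥ √(1 − ⟪u,v⟫²)` for unit vectors (the Gram determinant), the three pairs give
`2 Σ_{k≤3} sin θ_k ≥ 2·(2√2/3) + 4√2/9 = 16√2/9`, i.e. **`censusSum B κ ≥ 4√2/9 ≈ 0.6285 > 13/25` for every frame `B` and every reduced admissible `κ` with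
`|κ| ≥ 3`** (`censusSum_ge_of_three_le_length`; the true minimum is `5√2/9 ≈ 0.786`, at `e₃` = the third plane of an `x·y·x` word — not needed).  Hence a table
capped at `13/25` is census-dominated as soon as its LENGTH-2 (Σ9) words are (`censusDominatedAt_of_cap_of_two`): the finite certified table that (β) needs
(`CensusRegimeAt (13/25)` on the residual) concerns Σ9 pairs only, where `censusSum ≥ √2/3 ≈ 0.471` is all that holds in general (`censusSum_ge_of_two_le_length`).
WHAT THIS IS NOT: no configuration enters; no claim about which Σ9 cells are dominated; F-C1 not moved.
-/

noncomputable section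

open scoped BigOperators InnerProductSpace ENNReal
open MeasureTheory Filter

namespace Summit.Ventures.Crystal3D.Cruxes.TextureLiminf.TexShadow

open Summit.Ventures.Crystal3D Summit.Ventures.Crystal3D.Theorems
open Literature.MathematicalPhysics.StatisticalMechanics (IsHaggSeq fccStacking barlowStacking basalMirror)

/-! ## The sine triangle inequality for unit vectors -/

/-- **Gram inequality**: for unit `u, v, e`, `(⟪u,v⟫ − ⟪u,e⟫⟪v,e⟫)² ≤ (1 − ⟪u,e⟫²)(1 − ⟪v,e⟫²)` (Cauchy–Schwarz for the components orthogonal to `e`). -/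
theorem sq_inner_sub_mul_le {u v e : E3} (hu : ‖u‖ = 1) (hv : ‖v‖ = 1) (he : ‖e‖ = 1) :
    (⟪u, v⟫_ℝ - ⟪u, e⟫_ℝ * ⟪v, e⟫_ℝ) ^ 2 ≤ (1 - ⟪u, e⟫_ℝ ^ 2) * (1 - ⟪v, e⟫_ℝ ^ 2) := by
  set a := ⟪u, e⟫_ℝ with ha
  set b := ⟪v, e⟫_ℝ with hb
  have hee : ⟪e, e⟫_ℝ = 1 := by rw [real_inner_self_eq_norm_sq, he, one_pow]
  have huu : ⟪u, u⟫_ℝ = 1 := by rw [real_inner_self_eq_norm_sq, hu, one_pow]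
  have hvv : ⟪v, v⟫_ℝ = 1 := by rw [real_inner_self_eq_norm_sq, hv, one_pow]
  -- the components orthogonal to `e`
  set u' : E3 := u - a • e with hu'
  set v' : E3 := v - b • e with hv'
  have h1 : ⟪u', u'⟫_ℝ = 1 - a ^ 2 := by
    rw [hu', inner_sub_left, inner_sub_right, inner_sub_right, real_inner_smul_left, real_inner_smul_right, real_inner_smul_left,
      real_inner_smul_right, huu, hee, real_inner_comm u e, ← ha]; ring
  have h2 : ⟪v', v'⟫_ℝ = 1 - b ^ 2 := by
    rw [hv', inner_sub_left, inner_sub_right, inner_sub_right, real_inner_smul_left, real_inner_smul_right, real_inner_smul_left,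
      real_inner_smul_right, hvv, hee, real_inner_comm v e, ← hb]; ring
  have h3 : ⟪u', v'⟫_ℝ = ⟪u, v⟫_ℝ - a * b := by
    rw [hu', hv', inner_sub_left, inner_sub_right, inner_sub_right, real_inner_smul_left, real_inner_smul_right, real_inner_smul_left,
      real_inner_smul_right, hee, real_inner_comm v e, ← hb]; ring
  have hcs := real_inner_mul_inner_self_le u' v'
  rw [h1, h2, h3] at hcs
  nlinarith [hcs]

/-- **Sine triangle inequality**: for unit vectors `u, v, e` in `E3`, `√(1 − ⟪u,v⟫²) ≤ √(1 − ⟪u,e⟫²) + √(1 − ⟪v,e⟫²)` — the angle a line makes with two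
others is subadditive in the sine. -/
theorem sqrt_one_sub_inner_sq_le_add {u v e : E3} (hu : ‖u‖ = 1) (hv : ‖v‖ = 1) (he : ‖e‖ = 1) :
    Real.sqrt (1 - ⟪u, v⟫_ℝ ^ 2) ≤ Real.sqrt (1 - ⟪u, e⟫_ℝ ^ 2) + Real.sqrt (1 - ⟪v, e⟫_ℝ ^ 2) := by
  set a := ⟪u, e⟫_ℝ with ha
  set b := ⟪v, e⟫_ℝ with hb
  set c := ⟪u, v⟫_ℝ with hc
  have ha1 : a ^ 2 ≤ 1 := by
    have h := abs_real_inner_le_norm u e; rw [hu, he, one_mul, ← ha] at h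
    nlinarith [abs_nonneg a, sq_abs a]
  have hb1 : b ^ 2 ≤ 1 := by
    have h := abs_real_inner_le_norm v e; rw [hv, he, one_mul, ← hb] at h
    nlinarith [abs_nonneg b, sq_abs b]
  have hc1 : |c| ≤ 1 := by
    have h := abs_real_inner_le_norm u v; rwa [hu, hv, one_mul] at h
  set A := Real.sqrt (1 - a ^ 2) with hA
  set B := Real.sqrt (1 - b ^ 2) with hB
  have hA0 : 0 ≤ A := Real.sqrt_nonneg _
  have hB0 : 0 ≤ B := Real.sqrt_nonneg _
  have hA2 : A ^ 2 = 1 - a ^ 2 := Real.sq_sqrt (by linarith)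
  have hB2 : B ^ 2 = 1 - b ^ 2 := Real.sq_sqrt (by linarith)
  -- Gram: `(c − ab)² ≤ A²B²`, hence `|c − ab| ≤ AB`
  have hG : (c - a * b) ^ 2 ≤ (A * B) ^ 2 := by
    rw [mul_pow, hA2, hB2]; exact sq_inner_sub_mul_le hu hv he
  have hP : |c - a * b| ≤ A * B := abs_le_of_sq_le_sq hG (mul_nonneg hA0 hB0)
  -- the target, squared: `1 − c² ≤ (A + B)²`, from `c² + (AB)² − a²b² + 2AB ≥ 2|c − ab|(1 − |c|) ≥ 0`
  have hkey : 1 - c ^ 2 ≤ (A + B) ^ 2 := by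
    have h1 : 0 ≤ (1 - |c|) * (A * B - |c - a * b|) := mul_nonneg (by linarith) (by linarith)
    have h2 : -(|c| * |c - a * b|) ≤ c * (c - a * b) := by
      rw [← abs_mul]; exact neg_abs_le _
    have h3 : |c - a * b| ^ 2 = (c - a * b) ^ 2 := sq_abs _
    nlinarith [h1, h2, h3, hA2, hB2, abs_nonneg (c - a * b), abs_nonneg c, mul_nonneg hA0 hB0]
  calc Real.sqrt (1 - c ^ 2) ≤ Real.sqrt ((A + B) ^ 2) := Real.sqrt_le_sqrt hkey
    _ = A + B := Real.sqrt_sq (add_nonneg hA0 hB0)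

/-! ## The spatial normals of three consecutive letters -/

/-- Inner products with a reflected vector: `⟪x, R_μ y⟫ = ⟪x, y⟫ − 2⟪y, μ⟫⟪x, μ⟫` for a unit `μ`. -/
theorem inner_reflection_unit {μ : E3} (hμ : ‖μ‖ = 1) (x y : E3) :
    ⟪x, (ℝ ∙ μ)ᗮ.reflection y⟫_ℝ = ⟪x, y⟫_ℝ - 2 * ⟪y, μ⟫_ℝ * ⟪x, μ⟫_ℝ := by
  rw [reflection_unit_apply hμ, inner_sub_right, real_inner_smul_right]

/-- **The three spatial normals of consecutive letters** `μ₁ μ₂ μ₃` (unit menu normals, consecutive pairs at `±1/3`) read from the frame `B`: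
`v₁ = B μ₁`, `v₂ = B (R_{μ₁} μ₂)`, `v₃ = B (R_{μ₁} (R_{μ₂} μ₃))` are unit vectors with `⟪v₁,v₂⟫² = ⟪v₂,v₃⟫² = 1/9` and `⟪v₁,v₃⟫² ≤ 49/81`. -/
theorem chainNormals_inner {B : E3 ≃ₗᵢ[ℝ] E3} {μ₁ μ₂ μ₃ : E3}
    (h₁ : ‖μ₁‖ = 1 ∧ ∀ w ∈ fccSlots, ⟪w, μ₁⟫_ℝ = 0 ∨ ⟪w, μ₁⟫_ℝ = Real.sqrt (2 / 3) ∨ ⟪w, μ₁⟫_ℝ = -Real.sqrt (2 / 3))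
    (h₂ : ‖μ₂‖ = 1)
    (h₃ : ‖μ₃‖ = 1 ∧ ∀ w ∈ fccSlots, ⟪w, μ₃⟫_ℝ = 0 ∨ ⟪w, μ₃⟫_ℝ = Real.sqrt (2 / 3) ∨ ⟪w, μ₃⟫_ℝ = -Real.sqrt (2 / 3))
    (h12 : ⟪μ₁, μ₂⟫_ℝ = 1 / 3 ∨ ⟪μ₁, μ₂⟫_ℝ = -1 / 3) (h23 : ⟪μ₂, μ₃⟫_ℝ = 1 / 3 ∨ ⟪μ₂, μ₃⟫_ℝ = -1 / 3) :
    ⟪B μ₁, B ((ℝ ∙ μ₁)ᗮ.reflection μ₂)⟫_ℝ ^ 2 = 1 / 9 ∧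
      ⟪B ((ℝ ∙ μ₁)ᗮ.reflection μ₂), B ((ℝ ∙ μ₁)ᗮ.reflection ((ℝ ∙ μ₂)ᗮ.reflection μ₃))⟫_ℝ ^ 2 = 1 / 9 ∧
      ⟪B μ₁, B ((ℝ ∙ μ₁)ᗮ.reflection ((ℝ ∙ μ₂)ᗮ.reflection μ₃))⟫_ℝ ^ 2 ≤ 49 / 81 := by
  have hμ₁₁ : ⟪μ₁, μ₁⟫_ℝ = 1 := by rw [real_inner_self_eq_norm_sq, h₁.1, one_pow]
  refine ⟨?_, ?_, ?_⟩
  · rw [LinearIsometryEquiv.inner_map_map, inner_reflection_unit h₁.1, real_inner_comm μ₁ μ₂, hμ₁₁]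
    rcases h12 with h | h <;> rw [h] <;> norm_num
  · rw [LinearIsometryEquiv.inner_map_map, LinearIsometryEquiv.inner_map_map, inner_reflection_unit h₂,
      real_inner_comm μ₂ μ₃, real_inner_self_eq_norm_sq, h₂, one_pow]
    rcases h23 with h | h <;> rw [h] <;> norm_num
  · -- `⟪μ₁, R_{μ₁}(R_{μ₂} μ₃)⟫ = −⟪μ₁, R_{μ₂} μ₃⟫ = −(⟪μ₁,μ₃⟫ − 2⟪μ₂,μ₃⟫⟪μ₁,μ₂⟫)`
    rw [LinearIsometryEquiv.inner_map_map, inner_reflection_unit h₁.1, hμ₁₁,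
      real_inner_comm μ₁ ((ℝ ∙ μ₂)ᗮ.reflection μ₃), inner_reflection_unit h₂ μ₁ μ₃, real_inner_comm μ₂ μ₃]
    rcases inner_modelMenu h₁.1 h₃.1 h₁.2 h₃.2 with h13 | h13 | h13 | h13
    · -- `μ₃ = μ₁`
      have heq : μ₃ = μ₁ := ((inner_eq_one_iff_of_norm_eq_one (𝕜 := ℝ) h₁.1 h₃.1).1 h13).symm
      rw [heq, hμ₁₁, real_inner_comm μ₁ μ₂]
      rcases h12 with h | h <;> rw [h] <;> norm_num
    · -- `μ₃ = −μ₁`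
      have heq : μ₃ = -μ₁ := eq_neg_of_inner_eq_neg_one' h₁.1 h₃.1 h13
      rw [heq, inner_neg_right, inner_neg_right, hμ₁₁, real_inner_comm μ₁ μ₂]
      rcases h12 with h | h <;> rw [h] <;> norm_num
    · rw [h13]
      rcases h12 with h | h <;> rcases h23 with h' | h' <;> rw [h, h'] <;> norm_num
    · rw [h13]
      rcases h12 with h | h <;> rcases h23 with h' | h' <;> rw [h, h'] <;> norm_num

/-! ## The census of three letters, and of every longer word -/

/-- Monotonicity: the census of a word is at least the census of a prefix — appending letters adds nonnegative terms. -/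
theorem censusSum_append (B : E3 ≃ₗᵢ[ℝ] E3) :
    ∀ (κ₁ κ₂ : List E3), censusSum B κ₁ ≤ censusSum B (κ₁ ++ κ₂)
  | [], κ₂ => by rw [List.nil_append, censusSum_nil]; exact censusSum_nonneg _ _
  | μ :: rest, κ₂ => by
    rw [List.cons_append, censusSum_cons, censusSum_cons]
    have := censusSum_append (((ℝ ∙ μ)ᗮ.reflection).trans B) rest κ₂
    linarith

set_option maxHeartbeats 400000 in
/-- **Three consecutive letters already give `4√2/9`.** -/
theorem censusSum_three_ge (B : E3 ≃ₗᵢ[ℝ] E3) {μ₁ μ₂ μ₃ : E3}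
    (h₁ : ‖μ₁‖ = 1 ∧ ∀ w ∈ fccSlots, ⟪w, μ₁⟫_ℝ = 0 ∨ ⟪w, μ₁⟫_ℝ = Real.sqrt (2 / 3) ∨ ⟪w, μ₁⟫_ℝ = -Real.sqrt (2 / 3))
    (h₂ : ‖μ₂‖ = 1)
    (h₃ : ‖μ₃‖ = 1 ∧ ∀ w ∈ fccSlots, ⟪w, μ₃⟫_ℝ = 0 ∨ ⟪w, μ₃⟫_ℝ = Real.sqrt (2 / 3) ∨ ⟪w, μ₃⟫_ℝ = -Real.sqrt (2 / 3))
    (h12 : ⟪μ₁, μ₂⟫_ℝ = 1 / 3 ∨ ⟪μ₁, μ₂⟫_ℝ = -1 / 3) (h23 : ⟪μ₂, μ₃⟫_ℝ = 1 / 3 ∨ ⟪μ₂, μ₃⟫_ℝ = -1 / 3) (rest : List E3) :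
    4 * Real.sqrt 2 / 9 ≤ censusSum B (μ₁ :: μ₂ :: μ₃ :: rest) := by
  rw [censusSum_cons, censusSum_cons, censusSum_cons]
  simp only [LinearIsometryEquiv.trans_apply]
  set v₁ : E3 := B μ₁ with hv₁
  set v₂ : E3 := B ((ℝ ∙ μ₁)ᗮ.reflection μ₂) with hv₂
  set v₃ : E3 := B ((ℝ ∙ μ₁)ᗮ.reflection ((ℝ ∙ μ₂)ᗮ.reflection μ₃)) with hv₃
  have hn₁ : ‖v₁‖ = 1 := by rw [hv₁, LinearIsometryEquiv.norm_map, h₁.1]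
  have hn₂ : ‖v₂‖ = 1 := by rw [hv₂, LinearIsometryEquiv.norm_map, LinearIsometryEquiv.norm_map, h₂]
  have hn₃ : ‖v₃‖ = 1 := by rw [hv₃, LinearIsometryEquiv.norm_map, LinearIsometryEquiv.norm_map, LinearIsometryEquiv.norm_map, h₃.1]
  obtain ⟨h12', h23', h13'⟩ := chainNormals_inner (B := B) h₁ h₂ h₃ h12 h23
  have he := norm_e₃_eq_one
  -- the three sine triangle inequalities
  have t12 := sqrt_one_sub_inner_sq_le_add hn₁ hn₂ he
  have t23 := sqrt_one_sub_inner_sq_le_add hn₂ hn₃ he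
  have t13 := sqrt_one_sub_inner_sq_le_add hn₁ hn₃ he
  rw [← hv₁, ← hv₂] at h12'; rw [← hv₂, ← hv₃] at h23'; rw [← hv₁, ← hv₃] at h13'
  -- the constants: `√(1 − 1/9) = 2√2/3`, `√(1 − x) ≥ 4√2/9` for `x ≤ 49/81`
  have hs2 : (0 : ℝ) ≤ Real.sqrt 2 := Real.sqrt_nonneg 2
  have hs2sq : Real.sqrt 2 ^ 2 = 2 := Real.sq_sqrt (by norm_num)
  have c12 : Real.sqrt (1 - ⟪v₁, v₂⟫_ℝ ^ 2) = 2 * Real.sqrt 2 / 3 := by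
    rw [h12', show (1 : ℝ) - 1 / 9 = (2 * Real.sqrt 2 / 3) ^ 2 by nlinarith [hs2sq]]
    exact Real.sqrt_sq (by positivity)
  have c23 : Real.sqrt (1 - ⟪v₂, v₃⟫_ℝ ^ 2) = 2 * Real.sqrt 2 / 3 := by
    rw [h23', show (1 : ℝ) - 1 / 9 = (2 * Real.sqrt 2 / 3) ^ 2 by nlinarith [hs2sq]]
    exact Real.sqrt_sq (by positivity)
  have c13 : 4 * Real.sqrt 2 / 9 ≤ Real.sqrt (1 - ⟪v₁, v₃⟫_ℝ ^ 2) := by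
    rw [show 4 * Real.sqrt 2 / 9 = Real.sqrt ((4 * Real.sqrt 2 / 9) ^ 2) from (Real.sqrt_sq (by positivity)).symm]
    exact Real.sqrt_le_sqrt (by nlinarith [hs2sq])
  have hrest := censusSum_nonneg
    (((ℝ ∙ μ₃)ᗮ.reflection).trans (((ℝ ∙ μ₂)ᗮ.reflection).trans (((ℝ ∙ μ₁)ᗮ.reflection).trans B))) rest
  rw [c12] at t12; rw [c23] at t23
  nlinarith [t12, t23, t13, c13, hrest, Real.sqrt_nonneg (1 - ⟪v₁, e₃⟫_ℝ ^ 2), Real.sqrt_nonneg (1 - ⟪v₂, e₃⟫_ℝ ^ 2),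
    Real.sqrt_nonneg (1 - ⟪v₃, e₃⟫_ℝ ^ 2)]

/-- **THE CENSUS OF EVERY REDUCED ADMISSIBLE WORD OF LENGTH ≥ 3 IS ≥ `4√2/9 ≈ 0.6285`** (`> 13/25`), whatever the frame (hence whatever the wall normal). -/
theorem censusSum_ge_of_three_le_length (B : E3 ≃ₗᵢ[ℝ] E3) {κ : List E3}
    (hκl : ∀ μ ∈ κ, ‖μ‖ = 1 ∧
      ∀ w ∈ fccSlots, ⟪w, μ⟫_ℝ = 0 ∨ ⟪w, μ⟫_ℝ = Real.sqrt (2 / 3) ∨ ⟪w, μ⟫_ℝ = -Real.sqrt (2 / 3))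
    (hκc : List.IsChain (fun μ μ' => ⟪μ, μ'⟫_ℝ = 1 / 3 ∨ ⟪μ, μ'⟫_ℝ = -1 / 3) κ) (hlen : 3 ≤ κ.length) :
    4 * Real.sqrt 2 / 9 ≤ censusSum B κ := by
  match κ, hκl, hκc, hlen with
  | μ₁ :: μ₂ :: μ₃ :: rest, hκl, hκc, _ =>
    have h₁ := hκl μ₁ (by simp)
    have h₂ := hκl μ₂ (by simp)
    have h₃ := hκl μ₃ (by simp)
    rw [List.isChain_cons_cons, List.isChain_cons_cons] at hκc
    exact censusSum_three_ge B h₁ h₂.1 h₃ hκc.1 hκc.2.1 rest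

/-- `4√2/9 > 13/25` (so length-≥-3 words are census-dominated by any table capped at `13/25`). -/
theorem thirteen_div_lt_four_sqrt_two_div : (13 / 25 : ℝ) < 4 * Real.sqrt 2 / 9 := by
  have hs2sq : Real.sqrt 2 ^ 2 = 2 := Real.sq_sqrt (by norm_num)
  nlinarith [Real.sqrt_nonneg 2, hs2sq]

/-- For length `2` the census is still `≥ √2/3 ≈ 0.4714` (two consecutive normals at `|cos| = 1/3`; this is `< 13/25`: Σ9 words need the table). -/
theorem censusSum_ge_of_two_le_length (B : E3 ≃ₗᵢ[ℝ] E3) {κ : List E3}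
    (hκl : ∀ μ ∈ κ, ‖μ‖ = 1 ∧
      ∀ w ∈ fccSlots, ⟪w, μ⟫_ℝ = 0 ∨ ⟪w, μ⟫_ℝ = Real.sqrt (2 / 3) ∨ ⟪w, μ⟫_ℝ = -Real.sqrt (2 / 3))
    (hκc : List.IsChain (fun μ μ' => ⟪μ, μ'⟫_ℝ = 1 / 3 ∨ ⟪μ, μ'⟫_ℝ = -1 / 3) κ) (hlen : 2 ≤ κ.length) :
    Real.sqrt 2 / 3 ≤ censusSum B κ := by
  match κ, hκl, hκc, hlen with
  | μ₁ :: μ₂ :: rest, hκl, hκc, _ =>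
    have h₁ := hκl μ₁ (by simp)
    have h₂ := hκl μ₂ (by simp)
    rw [List.isChain_cons_cons] at hκc
    rw [censusSum_cons, censusSum_cons]
    simp only [LinearIsometryEquiv.trans_apply]
    set v₁ : E3 := B μ₁ with hv₁
    set v₂ : E3 := B ((ℝ ∙ μ₁)ᗮ.reflection μ₂) with hv₂
    have hn₁ : ‖v₁‖ = 1 := by rw [hv₁, LinearIsometryEquiv.norm_map, h₁.1]
    have hn₂ : ‖v₂‖ = 1 := by rw [hv₂, LinearIsometryEquiv.norm_map, LinearIsometryEquiv.norm_map, h₂.1]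
    have hμ₁₁ : ⟪μ₁, μ₁⟫_ℝ = 1 := by rw [real_inner_self_eq_norm_sq, h₁.1, one_pow]
    have h12' : ⟪v₁, v₂⟫_ℝ ^ 2 = 1 / 9 := by
      rw [hv₁, hv₂, LinearIsometryEquiv.inner_map_map, inner_reflection_unit h₁.1, real_inner_comm μ₁ μ₂, hμ₁₁]
      rcases hκc.1 with h | h <;> rw [h] <;> norm_num
    have t12 := sqrt_one_sub_inner_sq_le_add hn₁ hn₂ norm_e₃_eq_one
    have hs2sq : Real.sqrt 2 ^ 2 = 2 := Real.sq_sqrt (by norm_num)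
    have c12 : Real.sqrt (1 - ⟪v₁, v₂⟫_ℝ ^ 2) = 2 * Real.sqrt 2 / 3 := by
      rw [h12', show (1 : ℝ) - 1 / 9 = (2 * Real.sqrt 2 / 3) ^ 2 by nlinarith [hs2sq]]
      exact Real.sqrt_sq (by positivity)
    have hrest := censusSum_nonneg (((ℝ ∙ μ₂)ᗮ.reflection).trans (((ℝ ∙ μ₁)ᗮ.reflection).trans B)) rest
    rw [c12] at t12
    nlinarith [t12, hrest]

/-! ## Consequence for (β)'s table: only Σ9 words need checking -/

/-- **A table capped at `13/25` is census-dominated as soon as its length-2 words are**: for every pair `(i, j)` related by a reduced admissible word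
of length `2` the charge must be at most that word's census; words of length `≥ 3` are dominated automatically (`censusSum_ge_of_three_le_length`). -/
theorem censusDominatedAt_of_cap_of_two {A₁ A₂ : ℤ → (E3 ≃ₗᵢ[ℝ] E3)} {c : ℤ → ℤ → ℝ} (hcap : ∀ i j, c i j ≤ 13 / 25)
    (htwo : ∀ i j : ℤ, ∀ κ : List E3,
      (∀ μ ∈ κ, ‖μ‖ = 1 ∧
        ∀ w ∈ fccSlots, ⟪w, μ⟫_ℝ = 0 ∨ ⟪w, μ⟫_ℝ = Real.sqrt (2 / 3) ∨ ⟪w, μ⟫_ℝ = -Real.sqrt (2 / 3)) →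
      List.IsChain (fun μ μ' => ⟪μ, μ'⟫_ℝ = 1 / 3 ∨ ⟪μ, μ'⟫_ℝ = -1 / 3) κ →
      κ.length = 2 →
      A₂ j '' fccStacking 1 (Real.sqrt (2 / 3)) = (wordFrame (A₁ i) κ) '' fccStacking 1 (Real.sqrt (2 / 3)) →
        c i j ≤ censusSum (A₁ i) κ.reverse) :
    CensusDominatedAt A₁ A₂ c := by
  intro i j κ hκl hκc hlen himg
  rcases Nat.lt_or_ge κ.length 3 with hlt | hge
  · exact htwo i j κ hκl hκc (by omega) himg
  · -- length ≥ 3: the reversed word is admissible and a chain of the same length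
    have hκl' : ∀ μ ∈ κ.reverse, ‖μ‖ = 1 ∧
        ∀ w ∈ fccSlots, ⟪w, μ⟫_ℝ = 0 ∨ ⟪w, μ⟫_ℝ = Real.sqrt (2 / 3) ∨ ⟪w, μ⟫_ℝ = -Real.sqrt (2 / 3) :=
      fun μ hμ => hκl μ (List.mem_reverse.1 hμ)
    have hκc' : List.IsChain (fun μ μ' => ⟪μ, μ'⟫_ℝ = 1 / 3 ∨ ⟪μ, μ'⟫_ℝ = -1 / 3) κ.reverse := by
      rw [List.isChain_reverse]
      exact hκc.imp fun a b h => by rw [real_inner_comm]; exact h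
    exact (hcap i j).trans (thirteen_div_lt_four_sqrt_two_div.le.trans
      (censusSum_ge_of_three_le_length (A₁ i) hκl' hκc' (by rw [List.length_reverse]; exact hge)))

end Summit.Ventures.Crystal3D.Cruxes.TextureLiminf.TexShadow

end
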